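import Summits.BirchSwinnertonDyer.BirchSwinnertonDyer.Theorems.SmallImageMuTransferMuTransferX9CoreClosed
import Literature.NumberTheory.EllipticCurves.Kato2004.IwasawaH1NormCompatibleIntegral
import HarnessLib

/-!
# Crux `MuTransferX9` (stmt-BirchSwinnertonDyer-19276) after the close of `MuTransferX9Core` (19842):
# the F2 aside `KatoReductionModPKernel` (19844) and the crux itself, from the integrality of
# norm-compatible families (Kato Lemma 8.5 (2), weak and strong forms) in place of Kato §13.8

Cell `bsd-smallim`, seat `bsd-smallim-k6-g4` (gen 2).  THEOREMS ONLY (no definition, no named fact, no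
`sorry`); `--supports stmt-BirchSwinnertonDyer-19276` helper; closes NOTHING (every theorem here carries
hypotheses).  HONEST FRAMING: bookkeeping of the crux's CONDITIONAL SURFACE after k6-c2 g4's
`Theorems.smallImageMuTransfer_MuTransferX9Core_proof` (p476037: `MuTransferX9` modulo F1 ∧ F2 ∧ F3) and this
seat's Literature files `Kato2004/IwasawaH1ReductionKernel` (p473631: levelwise `ker red = p·H¹(U, T_pW)`),
`Kato2004/IwasawaH1ReductionRoots` (p475393/p477776: König roots; `mem_pSmul_of_red_eq_zero_of_integral`,
`mem_pSmul_of_red_eq_zero_of_integral_of_smul_mem`) and `Kato2004/IwasawaH1NormCompatibleIntegral` (p477208: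
the named fact `Kato2004.mem_integralH1_of_forall_layerCores_eq` = Kato Lemma 8.5 (2), strong form):

* `smallImageMuTransfer_KatoReductionModPKernel_of_normCompatibleIntegral` — F2 (item 19844, the by-name
  alias of `Kato2004.mem_pSmul_of_red_eq_zero`) from the WEAK Lemma 8.5 (2) («a norm-compatible family along
  the cyclotomic layers whose `p`-multiples are integral is integral» — the statement the cell proves in-tree,
  STATUS l.373/l.379, `UniversalNorms.mem_integralH1_of_layerCores_eq_of_smul_mem`); when that theorem lands,
  `smallImageMuTransfer_KatoReductionModPKernel_of_normCompatibleIntegral thatTheorem` is the one-line CLOSER of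
  19844 (`--workitem`), and `Kato2004.mem_pSmul_of_red_eq_zero` is discharged;
* `smallImageMuTransfer_KatoReductionModPKernel_of_lemma_8_5` — F2 from the STRONG named fact (Kato's printed
  Lemma 8.5 (2) on the pin's layers);
* `smallImageMuTransfer_MuTransferX9_of_normCompatibleIntegral` /
  `smallImageMuTransfer_MuTransferX9_of_lemma_8_5` — the crux `MuTransferX9` BY NAME from F1, the weak (resp.
  strong) Lemma 8.5 (2) and F3: the conditional surface of the deciding crux of rung K6 now reads
  «Kato Thm 12.5/12.6 inputs ∧ Lemma 8.5 (2) ∧ Poitou–Tate/ℚ».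

PARTITION (D-0054): X9 (A4; good-ordinary `p ∈ {5,7}`, `ρ̄` irreducible ∧ ¬surjective) — helper; closes NONE.
References: K. Kato, Astérisque 295 (2004) Lemma 8.5 (p. 183), §13.8 (pp. 228–229) [Kato2004Asterisque];
K. Rubin, *Euler Systems* (2000) App. B [Rubin2000].
-/

-- the summit and its single problem are both named `BirchSwinnertonDyer` (registry layout D-0017)
set_option linter.dupNamespace false
set_option autoImplicit false

noncomputable section

open Literature.NumberTheory.GaloisRepresentations
open Literature.NumberTheory.EllipticCurves Literature.NumberTheory.EllipticCurves.Kato2004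
open Literature.NumberTheory.EllipticCurves.Kato2004.EulerSystemValues

namespace Summit.BirchSwinnertonDyer.BirchSwinnertonDyer.Theorems

/-- **F2 (item 19844 `KatoReductionModPKernel`) from the weak Lemma 8.5 (2)**: if every norm-compatible family
`z_n ∈ H¹(ℚ_n, T_pW)` along the layers of a cyclotomic `ℤ_p`-extension whose `p`-multiples are integral is
integral, then Kato's §13.8 kernel statement `Kato2004.mem_pSmul_of_red_eq_zero` (= the item, by name) holds.
One-line closer of 19844 once the hypothesis is a tree theorem.
[cite: Kato2004Asterisque, §13.8 (pp. 228–229) with Lemma 8.5 (2) (p. 183)] -/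
theorem smallImageMuTransfer_KatoReductionModPKernel_of_normCompatibleIntegral
    (h85 : ∀ (W : WeierstrassCurve ℚ) [W.IsElliptic] (p : ℕ) [Fact p.Prime]
      [ContinuousSMul ℤ_[p] (W.tateModule p)] (κ : ZpExtension ℚ p), κ.IsCyclotomic →
      ∀ z : ∀ n : ℕ, H1 (tateRep W p) (κ.layerSubgroup n),
        (∀ n, layerCores (tateRep W p) κ n (z (n + 1)) = z n) →
          (∀ n, (p : ℤ_[p]) • z n ∈ integralH1 (tateRep W p) p (κ.layerSubgroup n)) →
            ∀ n, z n ∈ integralH1 (tateRep W p) p (κ.layerSubgroup n)) :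
    Summit.BirchSwinnertonDyer.BirchSwinnertonDyer.Theses.SmallImageMuTransfer.KatoReductionModPKernel :=
  mem_pSmul_of_red_eq_zero_of_integral_of_smul_mem h85

/-- **F2 (item 19844) from the strong named fact** `Kato2004.mem_integralH1_of_forall_layerCores_eq` (Kato's
printed Lemma 8.5 (2) read on the pin's layers). [cite: Kato2004Asterisque, Lemma 8.5 (2) (p. 183)] -/
theorem smallImageMuTransfer_KatoReductionModPKernel_of_lemma_8_5
    (h : Kato2004.mem_integralH1_of_forall_layerCores_eq) :
    Summit.BirchSwinnertonDyer.BirchSwinnertonDyer.Theses.SmallImageMuTransfer.KatoReductionModPKernel :=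
  mem_pSmul_of_red_eq_zero_of_lemma_8_5 h

/-- **The deciding crux `MuTransferX9` BY NAME from F1, the weak Lemma 8.5 (2) and F3** (k6-c2 g4's
`smallImageMuTransfer_MuTransferX9Core_proof` with F2 supplied by
`mem_pSmul_of_red_eq_zero_of_integral_of_smul_mem`): Kato's μ-transfer on class X9 is kernel-checked modulo
«Kato Thm 12.5/12.6 inputs ∧ (weak) Lemma 8.5 (2) ∧ Poitou–Tate over ℚ».
[cite: Kato2004Asterisque, §13.8 (pp. 228–229) with Lemma 8.5 (2) (p. 183)] -/
theorem smallImageMuTransfer_MuTransferX9_of_normCompatibleIntegral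
    (hfineZ : Kato2004.exists_divisibilityInputs_fineQuotient_zeta)
    (h85 : ∀ (W : WeierstrassCurve ℚ) [W.IsElliptic] (p : ℕ) [Fact p.Prime]
      [ContinuousSMul ℤ_[p] (W.tateModule p)] (κ : ZpExtension ℚ p), κ.IsCyclotomic →
      ∀ z : ∀ n : ℕ, H1 (tateRep W p) (κ.layerSubgroup n),
        (∀ n, layerCores (tateRep W p) κ n (z (n + 1)) = z n) →
          (∀ n, (p : ℤ_[p]) • z n ∈ integralH1 (tateRep W p) p (κ.layerSubgroup n)) →
            ∀ n, z n ∈ integralH1 (tateRep W p) p (κ.layerSubgroup n))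
    (hPT : Literature.NumberTheory.GaloisCohomology.poitouTate_sum_localTatePairing_eq_zero ℚ) :
    Summit.BirchSwinnertonDyer.BirchSwinnertonDyer.Theses.SmallImageMuTransfer.MuTransferX9 :=
  smallImageMuTransfer_MuTransferX9Core_proof hfineZ (mem_pSmul_of_red_eq_zero_of_integral_of_smul_mem h85) hPT

/-- **The deciding crux `MuTransferX9` BY NAME from F1, the strong named fact Lemma 8.5 (2) and F3.**
[cite: Kato2004Asterisque, §13.8 (pp. 228–229) with Lemma 8.5 (2) (p. 183)] -/
theorem smallImageMuTransfer_MuTransferX9_of_lemma_8_5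
    (hfineZ : Kato2004.exists_divisibilityInputs_fineQuotient_zeta)
    (h : Kato2004.mem_integralH1_of_forall_layerCores_eq)
    (hPT : Literature.NumberTheory.GaloisCohomology.poitouTate_sum_localTatePairing_eq_zero ℚ) :
    Summit.BirchSwinnertonDyer.BirchSwinnertonDyer.Theses.SmallImageMuTransfer.MuTransferX9 :=
  smallImageMuTransfer_MuTransferX9Core_proof hfineZ (mem_pSmul_of_red_eq_zero_of_lemma_8_5 h) hPT

end Summit.BirchSwinnertonDyer.BirchSwinnertonDyer.Theorems

end
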